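import Literature.NumberTheory.EllipticCurves.HeckeEigenvalueSupNormBoundProofs
import Literature.NumberTheory.EllipticCurves.NewformsLiftProofs
import Literature.NumberTheory.EllipticCurves.DeligneHeckeEigenvalueBoundProofs
import Literature.NumberTheory.EllipticCurves.HeckeOperatorsDiamondProofs
import Mathlib.FieldTheory.Finite.Basic
import Mathlib.NumberTheory.ModularForms.Bounds
import HarnessLib

/-!
# The trivial bound for Hecke eigenvalues is STRICT on cusp forms: `|λ| < (p + 1) p^{(k-2)/2}`

A proofs-only sibling of `HeckeEigenvalueSupNormBoundProofs` (theorems only; no definition, no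
named fact; D-0026). There the bound `‖λ‖² ≤ (p + 1)² p^{k-2}` for an eigenvalue `λ` of `T_p` on a
non-zero cusp form is obtained from the boundedness of the invariant function
`φ_f(τ) = |f(τ)|² (Im τ)^k` on `ℍ`. Here we prove that for `f ∈ S_k(Γ₀(N))`, `p ∤ N` prime, the
inequality is strict:

* `exists_forall_norm_petersson_le` — for a cusp form `f` of any weight for an arithmetic
  subgroup, `φ_f` ATTAINS its supremum on `ℍ` (it is continuous, invariant under a finite-index
  subgroup of `SL(2, ℤ)`, and tends to `0` at every cusp; so its supremum is the maximum of finitely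
  many translates over the standard fundamental domain truncated at a suitable height, a compact set —
  Mathlib's `ModularGroup.isCompact_truncatedFundamentalDomain`).
* `norm_sq_lt_of_heckeT_eq_smul` — **`‖λ‖² < (p + 1)² p^{k-2}`** for `f ∈ S_k(Γ₀(N))`, `f ≠ 0`,
  `T_p f = λ f`, `p ∤ N`: at a maximum point `τ₀` of `φ_f`, equality in the trivial bound forces
  every term of `T_p f = ∑_{j mod p} f∣(1 j; 0 p) + f∣diag(p, 1)` to be extremal, in particular
  `φ_f(p τ₀) = sup φ_f`; iterating, `φ_f(pⁿ τ₀) = sup φ_f > 0` for all `n`, contradicting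
  `φ_f → 0` as `Im τ → ∞` (a cusp form decays at `i∞`).
* `norm_lt_of_hasEigenvalue_heckeT` — every eigenvalue `μ` of `T_p` on `S_k(Γ₀(N))`, `p ∤ N`, has
  `‖μ‖ < (p + 1) p^{(k-2)/2}`; `norm_lt_of_hasEigenvalue_heckeT_weight_two`: `‖μ‖ < p + 1` in weight
  `2`, i.e. the Eisenstein eigenvalue `1 + p` of `T_p` does not occur on weight-`2` cusp forms
  (the weight-`≥ 3` separation `‖λ‖ < 1 + p^{k-1}` is already in the sibling file; weight `2` is the
  case where the non-strict trivial bound `p + 1` IS the Eisenstein eigenvalue).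
* `eq_zero_of_pow_eq_one_of_root_weight_two` — consequently, in weight `2`, **no root of
  `X² − a_p X + p` (`a_p` a `T_p`-eigenvalue on `S₂(Γ₀(N))`, `p ∤ N`) is a root of unity**: the
  eigenvalue is real (`conj_eq_of_hasEigenvalue_heckeT`, self-adjointness), so a unimodular root `z`
  forces `z = ±1` and `a_p = ±(p + 1)`. This is an elementary substitute for Deligne's theorem in
  "Euler factors of weight-`2` eigenforms do not vanish at (root of unity)`/p`".

## References

* F. Diamond, J. Shurman, *A first course in modular forms*, GTM 228 (2005): Prop. 5.2.1,
  Exercise 5.9.1(a), Thm. 5.5.3. [DiamondShurman2005]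
-/

noncomputable section

open scoped MatrixGroups ModularForm ComplexConjugate Modular

open CongruenceSubgroup UpperHalfPlane Filter Topology ModularGroup Matrix.SpecialLinearGroup

namespace Literature.NumberTheory.EllipticCurves.ModularForms

/-! ### The supremum of a cusp-form invariant is attained -/

section Attained

/-- A continuous nonnegative function on `ℍ` tending to `0` at `i∞` attains its supremum over the
standard fundamental domain `𝒟` (on the truncated domain `{τ ∈ 𝒟 : Im τ ≤ y}`, which is compact).
[folklore] -/
private theorem exists_isMaxOn_fd_of_tendsto_zero {g : ℍ → ℝ} (hg : Continuous g) (hg0 : ∀ τ, 0 ≤ g τ)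
    (h0 : Tendsto g atImInfty (𝓝 0)) :
    ∃ σ₀ ∈ 𝒟, ∀ σ ∈ 𝒟, g σ ≤ g σ₀ := by
  by_cases hpos : ∃ σ₁ ∈ 𝒟, 0 < g σ₁
  · obtain ⟨σ₁, hσ₁, hgσ₁⟩ := hpos
    have hev : ∀ᶠ τ in atImInfty, g τ < g σ₁ := h0.eventually (Iio_mem_nhds hgσ₁)
    obtain ⟨A, hA⟩ := (atImInfty_mem _).mp hev
    set Y : ℝ := max A σ₁.im with hY
    have hK : IsCompact (truncatedFundamentalDomain Y) := isCompact_truncatedFundamentalDomain Y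
    have hσ₁K : σ₁ ∈ truncatedFundamentalDomain Y := ⟨hσ₁, le_max_right _ _⟩
    obtain ⟨σ₀, hσ₀K, hmax⟩ := hK.exists_isMaxOn ⟨σ₁, hσ₁K⟩ hg.continuousOn
    refine ⟨σ₀, hσ₀K.1, fun σ hσ ↦ ?_⟩
    by_cases hσY : σ.im ≤ Y
    · exact hmax ⟨hσ, hσY⟩
    · have h1 : g σ < g σ₁ := hA σ ((le_max_left _ _).trans (le_of_lt (not_le.mp hσY)))
      exact h1.le.trans (hmax hσ₁K)
  · push Not at hpos
    obtain ⟨γ, hγ⟩ := exists_smul_mem_fd UpperHalfPlane.I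
    exact ⟨_, hγ, fun σ hσ ↦ (hpos σ hσ).trans (hg0 _)⟩

/-- A continuous nonnegative function on `ℍ`, invariant under a finite-index subgroup of `SL(2, ℤ)`
and tending to `0` at every cusp (i.e. `P (g • τ) → 0` as `Im τ → ∞` for every `g ∈ SL(2, ℤ)`),
attains its supremum on `ℍ`. [folklore] -/
private theorem exists_forall_le_of_subgroup_invariant_of_tendsto_zero {P : ℍ → ℝ} (hP : Continuous P)
    (hP0 : ∀ τ, 0 ≤ P τ) (hzero : ∀ g : SL(2, ℤ), Tendsto (fun τ ↦ P (g • τ)) atImInfty (𝓝 0))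
    {Γ : Subgroup SL(2, ℤ)} [Γ.FiniteIndex] (hinv : ∀ g ∈ Γ, ∀ τ, P (g • τ) = P τ) :
    ∃ τ₀, ∀ τ, P τ ≤ P τ₀ := by
  -- translates indexed by the finite quotient `SL(2, ℤ) ⧸ Γ`
  let P' : ℍ → SL(2, ℤ) ⧸ Γ → ℝ := fun τ ↦ Quotient.lift (fun g ↦ P (g⁻¹ • τ)) fun g h hgh ↦ by
    obtain ⟨j, hj, hj'⟩ : ∃ j ∈ Γ, h = g * j := by
      rw [← Quotient.eq_iff_equiv, Quotient.eq, QuotientGroup.leftRel_apply] at hgh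
      exact ⟨g⁻¹ * h, hgh, (mul_inv_cancel_left g h).symm⟩
    simp [-sl_moeb, hj', mul_smul, hinv j⁻¹ (inv_mem hj)]
  have hP'mk : ∀ (τ : ℍ) (g : SL(2, ℤ)), P' τ ⟦g⟧ = P (g⁻¹ • τ) := fun τ g ↦ rfl
  have hP'cont : ∀ γ, Continuous (P' · γ) := fun γ ↦ QuotientGroup.induction_on γ fun g ↦ by
    simp only [hP'mk, sl_moeb]
    fun_prop
  have hP'zero : ∀ γ, Tendsto (P' · γ) atImInfty (𝓝 0) := fun γ ↦
    QuotientGroup.induction_on γ fun g ↦ by simpa only [hP'mk] using hzero g⁻¹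
  have hP'0 : ∀ γ τ, 0 ≤ P' τ γ := fun γ ↦ QuotientGroup.induction_on γ fun g τ ↦ by
    rw [hP'mk]; exact hP0 _
  haveI : Fintype (SL(2, ℤ) ⧸ Γ) := Subgroup.fintypeQuotientOfFiniteIndex
  -- for each class, a maximiser over `𝒟`
  choose σ hσfd hσmax using fun γ ↦ exists_isMaxOn_fd_of_tendsto_zero (hP'cont γ) (hP'0 γ) (hP'zero γ)
  -- the best class
  obtain ⟨γ₀, -, hγ₀⟩ := Finset.exists_max_image (Finset.univ : Finset (SL(2, ℤ) ⧸ Γ))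
    (fun γ ↦ P' (σ γ) γ) ⟨⟦1⟧, Finset.mem_univ _⟩
  -- its maximiser, pulled back to `ℍ`
  obtain ⟨g₀, hg₀⟩ := Quotient.exists_rep γ₀
  refine ⟨g₀⁻¹ • σ γ₀, fun τ ↦ ?_⟩
  obtain ⟨g, hg⟩ := exists_smul_mem_fd τ
  have h1 : P τ = P' (g • τ) ⟦g⟧ := by rw [hP'mk, inv_smul_smul]
  have h2 : P (g₀⁻¹ • σ γ₀) = P' (σ γ₀) γ₀ := by rw [← hg₀, hP'mk]
  rw [h1, h2]
  exact (hσmax ⟦g⟧ (g • τ) hg).trans (hγ₀ ⟦g⟧ (Finset.mem_univ _))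

open ConjAct Pointwise in
/-- For a cusp form `f` (arithmetic level) and `g ∈ SL(2, ℤ)`: `‖petersson k f f (g • τ)‖ → 0` as
`Im τ → ∞` (the translate `f ∣ g` is a cusp form and decays at `i∞`; Mathlib
`petersson_isZeroAtImInfty_left`). [folklore] -/
private theorem tendsto_norm_petersson_smul_atImInfty {k : ℤ} {Γ : Subgroup (GL (Fin 2) ℝ)} [Γ.IsArithmetic]
    {F : Type*} [FunLike F ℍ ℂ] [CuspFormClass F Γ k] (f : F) (g : SL(2, ℤ)) :
    Tendsto (fun τ ↦ ‖petersson k f f (g • τ)‖) atImInfty (𝓝 0) := by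
  rw [← tendsto_zero_iff_norm_tendsto_zero]
  have : IsZeroAtImInfty (fun τ ↦ petersson k f f (g • τ)) := by
    simp_rw [← UpperHalfPlane.petersson_slash_SL]
    have : ((toConjAct (g : GL (Fin 2) ℝ)⁻¹) • Γ).IsArithmetic := by
      simpa [(show Rat.castHom ℝ = algebraMap ℚ ℝ by rfl), map_inv, map_mapGL]
        using! Subgroup.IsArithmetic.conj Γ (mapGL ℚ g)⁻¹
    exact (CuspFormClass.zero_at_infty <| CuspForm.translate f g).petersson_isZeroAtImInfty_left k _
      (ModularForm.translate f g)
  exact this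

/-- **The invariant `φ_f(τ) = |f(τ)|² (Im τ)^k` of a cusp form attains its supremum on `ℍ`**
(`f` a cusp form of weight `k` for an arithmetic subgroup `Γ`): there is `τ₀` with
`‖petersson k f f τ‖ ≤ ‖petersson k f f τ₀‖` for all `τ`. [cite: DiamondShurman2005, Exercise 5.9.1(a)] -/
theorem exists_forall_norm_petersson_le {k : ℤ} {Γ : Subgroup (GL (Fin 2) ℝ)} [Γ.IsArithmetic]
    {F : Type*} [FunLike F ℍ ℂ] [CuspFormClass F Γ k] (f : F) :
    ∃ τ₀ : ℍ, ∀ τ : ℍ, ‖petersson k f f τ‖ ≤ ‖petersson k f f τ₀‖ :=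
  exists_forall_le_of_subgroup_invariant_of_tendsto_zero (P := fun τ ↦ ‖petersson k f f τ‖)
    (by fun_prop) (fun _ ↦ norm_nonneg _) (tendsto_norm_petersson_smul_atImInfty f)
    (Γ := Γ.comap (mapGL ℝ)) (fun g hg τ ↦ SlashInvariantFormClass.norm_petersson_smul hg)

end Attained

/-! ### The strict trivial bound on `S_k(Γ₀(N))` -/

section Strict

variable {N : ℕ} [NeZero N] {k : ℤ} {p : ℕ} [NeZero p]

/-- `Im(β_∞ • τ) = p · Im τ` for `β_∞ = diag(p, 1)` (`β_∞ • τ = p τ`). [folklore] -/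
private theorem im_intGL_heckeRep_none_smul (τ : ℍ) :
    (intGL (heckeRep p none) • τ).im = (p : ℝ) * τ.im := by
  have hdet : (heckeRep p none).det ≠ 0 := det_heckeRep_ne_zero (NeZero.ne p) none
  have hden : UpperHalfPlane.denom (intGL (heckeRep p none)) (τ : ℂ) = 1 := by
    simp only [UpperHalfPlane.denom]
    rw [intGL_apply hdet, intGL_apply hdet]
    simp [heckeRep]
  have hd : |((intGL (heckeRep p none)).det : ℝˣ).val| = (p : ℝ) := by
    rw [det_intGL_val hdet, det_heckeRep]; simp
  rw [UpperHalfPlane.im_smul_eq_div_normSq, hden, hd]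
  simp

omit [NeZero N] in
/-- The cardinality of the index set of `T_p` on level `Γ₀(N)` for `p ∤ N` is `p + 1`. [folklore] -/
private theorem card_heckeIdx_of_not_dvd (hpN : ¬ p ∣ N) : Fintype.card (HeckeIdx N p) = p + 1 := by
  rw [Fintype.card_congr (Equiv.subtypeUnivEquiv fun (i : Option (ZMod p)) (_ : i = none) ↦ hpN),
    Fintype.card_option, ZMod.card]

/-- **The trivial bound for Hecke eigenvalues is strict**: for `f ∈ S_k(Γ₀(N))`, `f ≠ 0`, `p ∤ N`
prime and `T_p f = λ f`, `‖λ‖² < (p + 1)² p^{k-2}`. At a maximum point `τ₀` of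
`φ_f = |f|² (Im)^k` (`exists_forall_norm_petersson_le`), equality in the trivial bound would force
the term `f ∣ diag(p,1)` of `T_p f` to be extremal, `φ_f(p τ₀) = max φ_f`; iterating gives
`φ_f(pⁿ τ₀) = max φ_f > 0` for all `n`, contradicting the decay of `φ_f` at `i∞`.
[cite: DiamondShurman2005, Prop. 5.2.1 and Exercise 5.9.1(a)] -/
theorem norm_sq_lt_of_heckeT_eq_smul (hp : p.Prime) (hpN : ¬ p ∣ N) {f : CuspForm (Gamma0 N) k}
    (hf : f ≠ 0) {c : ℂ} (hc : heckeT (Gamma0 N) k p f = c • f) :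
    ‖c‖ ^ 2 < ((p : ℝ) + 1) ^ 2 * (p : ℝ) ^ (k - 2) := by
  classical
  -- the lift to `Γ₁(N)` and its Hecke relation
  set F : CuspForm (Gamma1 N) k := liftToGamma1 N k f with hFdef
  have hFf : (⇑F : ℍ → ℂ) = ⇑f := coe_liftToGamma1_holds N k f
  have hcF : heckeT (Gamma1 N) k p F = c • F := by rw [hFdef, heckeT_liftToGamma1, hc, map_smul]
  -- the invariant function and its maximum
  obtain ⟨τ₀, hτ₀⟩ := exists_forall_norm_petersson_le f
  set P : ℍ → ℝ := fun τ ↦ ‖petersson k (⇑f) (⇑f) τ‖ with hP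
  set M : ℝ := P τ₀ with hM
  have hPM : ∀ τ, P τ ≤ M := hτ₀
  obtain ⟨τ₁, hτ₁⟩ : ∃ τ₁, f τ₁ ≠ 0 := by
    by_contra h
    push Not at h
    exact hf (CuspForm.ext fun τ ↦ by rw [h τ, CuspForm.zero_apply])
  have hMpos : 0 < M := by
    refine lt_of_lt_of_le ?_ (hPM τ₁)
    simp only [hP, norm_petersson_self]
    exact mul_pos (pow_pos (norm_pos_iff.mpr hτ₁) 2) (zpow_pos τ₁.im_pos k)
  have hA : (0 : ℝ) < (p : ℝ) ^ (k - 2) := zpow_pos (by exact_mod_cast hp.pos) _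
  -- each translate: `φ_{(⟨εᵢ⟩F)∣βᵢ}(τ) ≤ p^{k-2} M`
  have hterm_le : ∀ (i : HeckeIdx N p) (τ : ℍ),
      ‖(⇑(diamondOp N k (heckeEps N p i.1) F) ∣[k] intGL (heckeRep p i.1)) τ‖ ^ 2 * τ.im ^ k ≤
        (p : ℝ) ^ (k - 2) * M := by
    intro i τ
    obtain ⟨σ, hσ⟩ := exists_gamma0Map_eq_holds N (isUnit_heckeEps hp i)
    rw [← hσ, ← norm_petersson_self, norm_petersson_self_slash_intGL_heckeRep,
      norm_petersson_self_diamondOp, hFf]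
    exact mul_le_mul_of_nonneg_left (hPM _) hA.le
  -- the term `i = ∞`: no diamond twist on a `Γ₀(N)`-form, it is `p^{k-2} φ_f(β_∞ • τ)`
  let iinf : HeckeIdx N p := ⟨none, fun _ ↦ hpN⟩
  have hterm_none : ∀ τ : ℍ,
      ‖(⇑(diamondOp N k (heckeEps N p iinf.1) F) ∣[k] intGL (heckeRep p iinf.1)) τ‖ ^ 2 * τ.im ^ k =
        (p : ℝ) ^ (k - 2) * P (intGL (heckeRep p none) • τ) := by
    intro τ
    have hdia : diamondOp N k (heckeEps N p iinf.1) F = F := by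
      rw [hFdef]; exact diamondOp_liftToGamma1 N k _ f
    rw [hdia, ← norm_petersson_self, norm_petersson_self_slash_intGL_heckeRep, hFf]
  -- the index set has `p + 1` elements
  set I : ℝ := ((Fintype.card (HeckeIdx N p) : ℕ) : ℝ) with hI
  have hIeq : I = (p : ℝ) + 1 := by rw [hI, card_heckeIdx_of_not_dvd hpN, Nat.cast_add, Nat.cast_one]
  have hIpos : 0 < I := by rw [hIeq]; positivity
  -- the key estimate at an arbitrary point: `‖c‖² φ(τ) ≤ I · (p^{k-2} φ(β_∞ τ) + (I - 1) p^{k-2} M)`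
  have hpoint : ∀ τ : ℍ, ‖c‖ ^ 2 * P τ ≤
      I * ((p : ℝ) ^ (k - 2) * P (intGL (heckeRep p none) • τ) + (I - 1) * ((p : ℝ) ^ (k - 2) * M)) := by
    intro τ
    have hTf : ‖heckeT (Gamma1 N) k p F τ‖ = ‖c‖ * ‖f τ‖ := by
      rw [hcF, CuspForm.IsGLPos.coe_smul, Pi.smul_apply, smul_eq_mul, norm_mul, hFf]
    have hsum : ‖heckeT (Gamma1 N) k p F τ‖ ≤
        ∑ i : HeckeIdx N p, ‖(⇑(diamondOp N k (heckeEps N p i.1) F) ∣[k] intGL (heckeRep p i.1)) τ‖ := by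
      rw [coe_heckeT_gamma1 N k p hp F, Finset.sum_apply]
      exact norm_sum_le _ _
    have hCS := sq_sum_le_card_mul_sum_sq (s := (Finset.univ : Finset (HeckeIdx N p)))
      (f := fun i : HeckeIdx N p ↦
        ‖(⇑(diamondOp N k (heckeEps N p i.1) F) ∣[k] intGL (heckeRep p i.1)) τ‖)
    rw [Finset.card_univ] at hCS
    have hk0 : 0 ≤ τ.im ^ k := zpow_nonneg τ.im_pos.le k
    -- split the sum of the `sᵢ := ‖tᵢ τ‖² (Im τ)^k` at `i = ∞`
    set s : HeckeIdx N p → ℝ := fun i ↦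
      ‖(⇑(diamondOp N k (heckeEps N p i.1) F) ∣[k] intGL (heckeRep p i.1)) τ‖ ^ 2 * τ.im ^ k with hs
    have hsplit : ∑ i, s i = s iinf + ∑ i ∈ Finset.univ.erase iinf, s i :=
      (Finset.add_sum_erase _ _ (Finset.mem_univ iinf)).symm
    have hrest : ∑ i ∈ Finset.univ.erase iinf, s i ≤ (I - 1) * ((p : ℝ) ^ (k - 2) * M) := by
      have h := Finset.sum_le_card_nsmul (Finset.univ.erase iinf) s ((p : ℝ) ^ (k - 2) * M)
        fun i _ ↦ hterm_le i τ
      rw [Finset.card_erase_of_mem (Finset.mem_univ _), Finset.card_univ, nsmul_eq_mul] at h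
      have hc1 : (((Fintype.card (HeckeIdx N p) - 1 : ℕ)) : ℝ) = I - 1 := by
        rw [hI, Nat.cast_sub (Fintype.card_pos_iff.mpr ⟨iinf⟩), Nat.cast_one]
      rwa [hc1] at h
    calc ‖c‖ ^ 2 * P τ = ‖heckeT (Gamma1 N) k p F τ‖ ^ 2 * τ.im ^ k := by
          simp only [hP, norm_petersson_self, hTf]; ring
      _ ≤ (∑ i : HeckeIdx N p,
            ‖(⇑(diamondOp N k (heckeEps N p i.1) F) ∣[k] intGL (heckeRep p i.1)) τ‖) ^ 2 * τ.im ^ k :=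
          mul_le_mul_of_nonneg_right (pow_le_pow_left₀ (norm_nonneg _) hsum 2) hk0
      _ ≤ (I * ∑ i : HeckeIdx N p,
            ‖(⇑(diamondOp N k (heckeEps N p i.1) F) ∣[k] intGL (heckeRep p i.1)) τ‖ ^ 2) * τ.im ^ k :=
          mul_le_mul_of_nonneg_right hCS hk0
      _ = I * ∑ i : HeckeIdx N p, s i := by
          rw [mul_assoc, Finset.sum_mul]
      _ = I * (s iinf + ∑ i ∈ Finset.univ.erase iinf, s i) := by rw [hsplit]
      _ ≤ I * ((p : ℝ) ^ (k - 2) * P (intGL (heckeRep p none) • τ) + (I - 1) * ((p : ℝ) ^ (k - 2) * M)) := by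
          refine mul_le_mul_of_nonneg_left (add_le_add (le_of_eq ?_) hrest) hIpos.le
          exact hterm_none τ
  -- the non-strict bound (the sibling file), so that `¬ <` means `=`
  by_contra hlt
  have hge : ((p : ℝ) + 1) ^ 2 * (p : ℝ) ^ (k - 2) ≤ ‖c‖ ^ 2 := not_lt.mp hlt
  -- propagation: a maximum point `τ` of `φ_f` has `β_∞ • τ` a maximum point
  have hstep : ∀ τ : ℍ, P τ = M → P (intGL (heckeRep p none) • τ) = M := by
    intro τ hτ
    refine le_antisymm (hPM _) ?_
    have h1 := hpoint τ
    rw [hτ, hIeq] at h1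
    have h2 : ((p : ℝ) + 1) ^ 2 * (p : ℝ) ^ (k - 2) * M ≤ ‖c‖ ^ 2 * M :=
      mul_le_mul_of_nonneg_right hge hMpos.le
    -- `(p+1)² A M ≤ (p+1) (A X + p A M)` ⟹ `A M ≤ A X` ⟹ `M ≤ X`
    have h3 : ((p : ℝ) + 1) * ((p : ℝ) ^ (k - 2) * M) ≤
        ((p : ℝ) + 1) * ((p : ℝ) ^ (k - 2) * P (intGL (heckeRep p none) • τ)) := by
      nlinarith [h1, h2, hA, hMpos]
    have h4 := le_of_mul_le_mul_left h3 (by positivity : (0 : ℝ) < (p : ℝ) + 1)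
    exact le_of_mul_le_mul_left h4 hA
  -- iterate: `φ_f(β_∞^[n] τ₀) = M` and `Im(β_∞^[n] τ₀) = pⁿ Im τ₀`
  have hiter : ∀ n : ℕ, P ((fun τ : ℍ ↦ intGL (heckeRep p none) • τ)^[n] τ₀) = M := by
    intro n
    induction n with
    | zero => rfl
    | succ n ih =>
        rw [Function.iterate_succ_apply']
        exact hstep _ ih
  have him : ∀ n : ℕ, ((fun τ : ℍ ↦ intGL (heckeRep p none) • τ)^[n] τ₀).im = (p : ℝ) ^ n * τ₀.im := by
    intro n
    induction n with
    | zero => simp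
    | succ n ih => rw [Function.iterate_succ_apply', im_intGL_heckeRep_none_smul, ih, pow_succ]; ring
  -- decay at `i∞`
  have hdec : Tendsto P atImInfty (𝓝 0) := by
    simpa only [hP, one_smul] using tendsto_norm_petersson_smul_atImInfty f (1 : SL(2, ℤ))
  obtain ⟨A, hAim⟩ := (atImInfty_mem _).mp (hdec.eventually (Iio_mem_nhds hMpos))
  obtain ⟨n, hn⟩ := exists_nat_gt (A / τ₀.im)
  have hnp : (n : ℝ) ≤ (p : ℝ) ^ n := by exact_mod_cast (Nat.lt_pow_self hp.one_lt).le
  have hAn : A ≤ ((fun τ : ℍ ↦ intGL (heckeRep p none) • τ)^[n] τ₀).im := by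
    rw [him n]
    have h0 : 0 < τ₀.im := τ₀.im_pos
    rw [div_lt_iff₀ h0] at hn
    nlinarith [hnp, h0]
  have hcon : P ((fun τ : ℍ ↦ intGL (heckeRep p none) • τ)^[n] τ₀) < M := hAim _ hAn
  rw [hiter n] at hcon
  exact lt_irrefl _ hcon

/-- **Every eigenvalue of `T_p` (`p ∤ N` prime) on `S_k(Γ₀(N))` satisfies `‖μ‖ < (p + 1) p^{(k-2)/2}`**
(strict Hecke bound). [cite: DiamondShurman2005, Prop. 5.2.1 and Exercise 5.9.1(a)] -/
theorem norm_lt_of_hasEigenvalue_heckeT (hp : p.Prime) (hpN : ¬ p ∣ N) {μ : ℂ}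
    (hμ : Module.End.HasEigenvalue (heckeT (Gamma0 N) k p) μ) :
    ‖μ‖ < ((p : ℝ) + 1) * (p : ℝ) ^ (((k : ℝ) - 2) / 2) := by
  obtain ⟨f, hf⟩ := hμ.exists_hasEigenvector
  have h := norm_sq_lt_of_heckeT_eq_smul hp hpN hf.2 hf.apply_eq_smul
  have hp0 : (0 : ℝ) ≤ p := Nat.cast_nonneg p
  refine lt_of_pow_lt_pow_left₀ 2 (by positivity) ?_
  rw [mul_pow, show ((k : ℝ) - 2) = ((k - 2 : ℤ) : ℝ) by push_cast; ring,
    rpow_intCast_div_two_sq hp0 (k - 2)]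
  exact h

/-- **Weight two: `‖μ‖ < p + 1`** for every eigenvalue `μ` of `T_p` (`p ∤ N`) on `S₂(Γ₀(N))` — the
Eisenstein eigenvalue `1 + p` does not occur on weight-`2` cusp forms. [cite: DiamondShurman2005, Prop. 5.2.1] -/
theorem norm_lt_of_hasEigenvalue_heckeT_weight_two (hp : p.Prime) (hpN : ¬ p ∣ N) {μ : ℂ}
    (hμ : Module.End.HasEigenvalue (heckeT (Gamma0 N) 2 p) μ) :
    ‖μ‖ < (p : ℝ) + 1 := by
  have h := norm_lt_of_hasEigenvalue_heckeT (k := 2) hp hpN hμ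
  norm_num at h
  exact h

/-- **In weight `2`, no root of `X² − μ X + p` is a root of unity** (`μ` an eigenvalue of `T_p`,
`p ∤ N`, on `S₂(Γ₀(N))`): such a root `z` has `|z| = 1`, and since `μ = z + p z̄` is real
(`conj_eq_of_hasEigenvalue_heckeT`), `z = z̄ = ±1` and `μ = ±(p + 1)`, contradicting
`norm_lt_of_hasEigenvalue_heckeT_weight_two`. An elementary substitute for Deligne's bound in
statements of the form "the Euler factor `1 − a_p p^{-s} + p^{1-2s}` of a weight-`2` eigenform has no
zero at `p^{-s}` a root of unity times `p⁻¹`". [cite: DiamondShurman2005, Thm. 5.5.3 and Prop. 5.2.1] -/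
theorem false_of_rootOfUnity_root_weight_two (hp : p.Prime) (hpN : ¬ p ∣ N) {μ : ℂ}
    (hμ : Module.End.HasEigenvalue (heckeT (Gamma0 N) 2 p) μ) {z : ℂ} {m : ℕ} (hm : 0 < m)
    (hzm : z ^ m = 1) (hroot : z ^ 2 - μ * z + (p : ℂ) = 0) : False := by
  have hz1 : ‖z‖ = 1 := by
    have h : ‖z‖ ^ m = 1 := by rw [← norm_pow, hzm, norm_one]
    exact (pow_eq_one_iff_of_nonneg (norm_nonneg z) hm.ne').mp h
  have hz0 : z ≠ 0 := fun h ↦ by simp [h] at hz1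
  have hzz : z * conj z = 1 := by
    rw [Complex.mul_conj, Complex.normSq_eq_norm_sq, hz1]; norm_num
  -- `μ = z + p conj z`
  have hμz : μ = z + (p : ℂ) * conj z := by
    have h1 : μ * z = z ^ 2 + (p : ℂ) := by linear_combination -hroot
    have h2 : μ = (z ^ 2 + (p : ℂ)) * conj z := by
      rw [← h1, mul_assoc, hzz, mul_one]
    rw [h2]; linear_combination z * hzz
  -- `μ` real ⟹ `z` real
  have hreal : conj μ = μ := conj_eq_of_hasEigenvalue_heckeT hp hpN hμ
  have hzreal : conj z = z := by
    have h := hreal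
    rw [hμz, map_add, map_mul, Complex.conj_conj, map_natCast] at h
    -- `conj z + p z = z + p conj z` ⟹ `(p - 1) (z - conj z) = 0`
    have h' : ((p : ℂ) - 1) * (z - conj z) = 0 := by linear_combination h
    rcases mul_eq_zero.mp h' with h'' | h''
    · exfalso
      have : (p : ℂ) = 1 := by linear_combination h''
      exact hp.one_lt.ne' (by exact_mod_cast this)
    · exact (sub_eq_zero.mp h'').symm
  -- so `z = ±1` and `μ = ±(p+1)`, `‖μ‖ = p + 1`
  have hz2 : z * z = 1 := by rw [← hzz, hzreal]
  have hμ' : μ = z * ((p : ℂ) + 1) := by rw [hμz, hzreal]; ring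
  have hnorm : ‖μ‖ = (p : ℝ) + 1 := by
    rw [hμ', norm_mul, hz1, one_mul]
    exact_mod_cast Complex.norm_natCast (p + 1)
  have hlt := norm_lt_of_hasEigenvalue_heckeT_weight_two hp hpN hμ
  rw [hnorm] at hlt
  exact lt_irrefl _ hlt

end Strict


/-! ### Appended (same seat): the strict bound on `S_k(Γ₁(N))` at primes `p ≡ 1 (mod N)` -/

section StrictGamma1

variable {N : ℕ} [NeZero N] {k : ℤ} {p : ℕ} [NeZero p]

/-- **Strict trivial bound on `S_k(Γ₁(N))` at primes `p ≡ 1 (mod N)`** (where the diamond twist `⟨p⟩` of the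
term `f ∣ diag(p,1)` of `T_p f` is trivial, `diamondOp_one_eq_id`): `f ≠ 0`, `T_p f = λ f` ⟹ `‖λ‖² < (p + 1)² p^{k-2}`;
same proof as `norm_sq_lt_of_heckeT_eq_smul`. In weight `2` this says that `1 + p`, the eigenvalue of `T_p`
(`p ≡ 1 mod N`) on the boundary line of the cusp `∞`, is NOT an eigenvalue of `T_p` on `S₂(Γ₁(N))` — the weight-`2`
companion of `ker_heckeT_gamma1_sub_eq_bot` (`k ≥ 3`, sibling file) used in Manin–Drinfeld-type arguments
(cf. the scope note of `PeriodLatticeK1ClosedPathsProofs`). [cite: DiamondShurman2005, Prop. 5.2.1 and Exercise 5.9.1(a)] -/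
theorem norm_sq_lt_of_heckeT_gamma1_eq_smul_of_cast_eq_one (hp : p.Prime) (hp1 : (p : ZMod N) = 1)
    {f : CuspForm (Gamma1 N) k} (hf : f ≠ 0) {c : ℂ} (hc : heckeT (Gamma1 N) k p f = c • f) :
    ‖c‖ ^ 2 < ((p : ℝ) + 1) ^ 2 * (p : ℝ) ^ (k - 2) := by
  classical
  -- `p ∤ N` (as `p ≡ 1 mod N`); no lift needed: `F = f`
  have hpN : ¬ p ∣ N := by
    intro h
    have h1 : N ∣ p - 1 := (Nat.modEq_iff_dvd' hp.one_lt.le).mp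
      ((ZMod.natCast_eq_natCast_iff' p 1 N).mp (by rw [hp1, Nat.cast_one])).symm
    have h2 : p ∣ p - 1 := h.trans h1
    have h3 : 0 < p - 1 := by have := hp.two_le; omega
    have h4 := Nat.le_of_dvd h3 h2
    omega
  set F : CuspForm (Gamma1 N) k := f with hFdef
  have hFf : (⇑F : ℍ → ℂ) = ⇑f := rfl
  have hcF : heckeT (Gamma1 N) k p F = c • F := hc
  -- the invariant function and its maximum
  obtain ⟨τ₀, hτ₀⟩ := exists_forall_norm_petersson_le f
  set P : ℍ → ℝ := fun τ ↦ ‖petersson k (⇑f) (⇑f) τ‖ with hP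
  set M : ℝ := P τ₀ with hM
  have hPM : ∀ τ, P τ ≤ M := hτ₀
  obtain ⟨τ₁, hτ₁⟩ : ∃ τ₁, f τ₁ ≠ 0 := by
    by_contra h
    push Not at h
    exact hf (CuspForm.ext fun τ ↦ by rw [h τ, CuspForm.zero_apply])
  have hMpos : 0 < M := by
    refine lt_of_lt_of_le ?_ (hPM τ₁)
    simp only [hP, norm_petersson_self]
    exact mul_pos (pow_pos (norm_pos_iff.mpr hτ₁) 2) (zpow_pos τ₁.im_pos k)
  have hA : (0 : ℝ) < (p : ℝ) ^ (k - 2) := zpow_pos (by exact_mod_cast hp.pos) _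
  -- each translate: `φ_{(⟨εᵢ⟩F)∣βᵢ}(τ) ≤ p^{k-2} M`
  have hterm_le : ∀ (i : HeckeIdx N p) (τ : ℍ),
      ‖(⇑(diamondOp N k (heckeEps N p i.1) F) ∣[k] intGL (heckeRep p i.1)) τ‖ ^ 2 * τ.im ^ k ≤
        (p : ℝ) ^ (k - 2) * M := by
    intro i τ
    obtain ⟨σ, hσ⟩ := exists_gamma0Map_eq_holds N (isUnit_heckeEps hp i)
    rw [← hσ, ← norm_petersson_self, norm_petersson_self_slash_intGL_heckeRep,
      norm_petersson_self_diamondOp, hFf]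
    exact mul_le_mul_of_nonneg_left (hPM _) hA.le
  -- the term `i = ∞`: no diamond twist on a `Γ₀(N)`-form, it is `p^{k-2} φ_f(β_∞ • τ)`
  let iinf : HeckeIdx N p := ⟨none, fun _ ↦ hpN⟩
  have hterm_none : ∀ τ : ℍ,
      ‖(⇑(diamondOp N k (heckeEps N p iinf.1) F) ∣[k] intGL (heckeRep p iinf.1)) τ‖ ^ 2 * τ.im ^ k =
        (p : ℝ) ^ (k - 2) * P (intGL (heckeRep p none) • τ) := by
    intro τ
    have hdia : diamondOp N k (heckeEps N p iinf.1) F = F := by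
      change diamondOp N k (p : ZMod N) F = F
      rw [hp1, diamondOp_one_eq_id, LinearMap.id_apply]
    rw [hdia, ← norm_petersson_self, norm_petersson_self_slash_intGL_heckeRep, hFf]
  -- the index set has `p + 1` elements
  set I : ℝ := ((Fintype.card (HeckeIdx N p) : ℕ) : ℝ) with hI
  have hIeq : I = (p : ℝ) + 1 := by rw [hI, card_heckeIdx_of_not_dvd hpN, Nat.cast_add, Nat.cast_one]
  have hIpos : 0 < I := by rw [hIeq]; positivity
  -- the key estimate at an arbitrary point: `‖c‖² φ(τ) ≤ I · (p^{k-2} φ(β_∞ τ) + (I - 1) p^{k-2} M)`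
  have hpoint : ∀ τ : ℍ, ‖c‖ ^ 2 * P τ ≤
      I * ((p : ℝ) ^ (k - 2) * P (intGL (heckeRep p none) • τ) + (I - 1) * ((p : ℝ) ^ (k - 2) * M)) := by
    intro τ
    have hTf : ‖heckeT (Gamma1 N) k p F τ‖ = ‖c‖ * ‖f τ‖ := by
      rw [hcF, CuspForm.IsGLPos.coe_smul, Pi.smul_apply, smul_eq_mul, norm_mul, hFf]
    have hsum : ‖heckeT (Gamma1 N) k p F τ‖ ≤
        ∑ i : HeckeIdx N p, ‖(⇑(diamondOp N k (heckeEps N p i.1) F) ∣[k] intGL (heckeRep p i.1)) τ‖ := by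
      rw [coe_heckeT_gamma1 N k p hp F, Finset.sum_apply]
      exact norm_sum_le _ _
    have hCS := sq_sum_le_card_mul_sum_sq (s := (Finset.univ : Finset (HeckeIdx N p)))
      (f := fun i : HeckeIdx N p ↦
        ‖(⇑(diamondOp N k (heckeEps N p i.1) F) ∣[k] intGL (heckeRep p i.1)) τ‖)
    rw [Finset.card_univ] at hCS
    have hk0 : 0 ≤ τ.im ^ k := zpow_nonneg τ.im_pos.le k
    -- split the sum of the `sᵢ := ‖tᵢ τ‖² (Im τ)^k` at `i = ∞`
    set s : HeckeIdx N p → ℝ := fun i ↦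
      ‖(⇑(diamondOp N k (heckeEps N p i.1) F) ∣[k] intGL (heckeRep p i.1)) τ‖ ^ 2 * τ.im ^ k with hs
    have hsplit : ∑ i, s i = s iinf + ∑ i ∈ Finset.univ.erase iinf, s i :=
      (Finset.add_sum_erase _ _ (Finset.mem_univ iinf)).symm
    have hrest : ∑ i ∈ Finset.univ.erase iinf, s i ≤ (I - 1) * ((p : ℝ) ^ (k - 2) * M) := by
      have h := Finset.sum_le_card_nsmul (Finset.univ.erase iinf) s ((p : ℝ) ^ (k - 2) * M)
        fun i _ ↦ hterm_le i τ
      rw [Finset.card_erase_of_mem (Finset.mem_univ _), Finset.card_univ, nsmul_eq_mul] at h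
      have hc1 : (((Fintype.card (HeckeIdx N p) - 1 : ℕ)) : ℝ) = I - 1 := by
        rw [hI, Nat.cast_sub (Fintype.card_pos_iff.mpr ⟨iinf⟩), Nat.cast_one]
      rwa [hc1] at h
    calc ‖c‖ ^ 2 * P τ = ‖heckeT (Gamma1 N) k p F τ‖ ^ 2 * τ.im ^ k := by
          simp only [hP, norm_petersson_self, hTf]; ring
      _ ≤ (∑ i : HeckeIdx N p,
            ‖(⇑(diamondOp N k (heckeEps N p i.1) F) ∣[k] intGL (heckeRep p i.1)) τ‖) ^ 2 * τ.im ^ k :=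
          mul_le_mul_of_nonneg_right (pow_le_pow_left₀ (norm_nonneg _) hsum 2) hk0
      _ ≤ (I * ∑ i : HeckeIdx N p,
            ‖(⇑(diamondOp N k (heckeEps N p i.1) F) ∣[k] intGL (heckeRep p i.1)) τ‖ ^ 2) * τ.im ^ k :=
          mul_le_mul_of_nonneg_right hCS hk0
      _ = I * ∑ i : HeckeIdx N p, s i := by
          rw [mul_assoc, Finset.sum_mul]
      _ = I * (s iinf + ∑ i ∈ Finset.univ.erase iinf, s i) := by rw [hsplit]
      _ ≤ I * ((p : ℝ) ^ (k - 2) * P (intGL (heckeRep p none) • τ) + (I - 1) * ((p : ℝ) ^ (k - 2) * M)) := by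
          refine mul_le_mul_of_nonneg_left (add_le_add (le_of_eq ?_) hrest) hIpos.le
          exact hterm_none τ
  -- the non-strict bound (the sibling file), so that `¬ <` means `=`
  by_contra hlt
  have hge : ((p : ℝ) + 1) ^ 2 * (p : ℝ) ^ (k - 2) ≤ ‖c‖ ^ 2 := not_lt.mp hlt
  -- propagation: a maximum point `τ` of `φ_f` has `β_∞ • τ` a maximum point
  have hstep : ∀ τ : ℍ, P τ = M → P (intGL (heckeRep p none) • τ) = M := by
    intro τ hτ
    refine le_antisymm (hPM _) ?_
    have h1 := hpoint τ
    rw [hτ, hIeq] at h1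
    have h2 : ((p : ℝ) + 1) ^ 2 * (p : ℝ) ^ (k - 2) * M ≤ ‖c‖ ^ 2 * M :=
      mul_le_mul_of_nonneg_right hge hMpos.le
    -- `(p+1)² A M ≤ (p+1) (A X + p A M)` ⟹ `A M ≤ A X` ⟹ `M ≤ X`
    have h3 : ((p : ℝ) + 1) * ((p : ℝ) ^ (k - 2) * M) ≤
        ((p : ℝ) + 1) * ((p : ℝ) ^ (k - 2) * P (intGL (heckeRep p none) • τ)) := by
      nlinarith [h1, h2, hA, hMpos]
    have h4 := le_of_mul_le_mul_left h3 (by positivity : (0 : ℝ) < (p : ℝ) + 1)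
    exact le_of_mul_le_mul_left h4 hA
  -- iterate: `φ_f(β_∞^[n] τ₀) = M` and `Im(β_∞^[n] τ₀) = pⁿ Im τ₀`
  have hiter : ∀ n : ℕ, P ((fun τ : ℍ ↦ intGL (heckeRep p none) • τ)^[n] τ₀) = M := by
    intro n
    induction n with
    | zero => rfl
    | succ n ih =>
        rw [Function.iterate_succ_apply']
        exact hstep _ ih
  have him : ∀ n : ℕ, ((fun τ : ℍ ↦ intGL (heckeRep p none) • τ)^[n] τ₀).im = (p : ℝ) ^ n * τ₀.im := by
    intro n
    induction n with
    | zero => simp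
    | succ n ih => rw [Function.iterate_succ_apply', im_intGL_heckeRep_none_smul, ih, pow_succ]; ring
  -- decay at `i∞`
  have hdec : Tendsto P atImInfty (𝓝 0) := by
    simpa only [hP, one_smul] using tendsto_norm_petersson_smul_atImInfty f (1 : SL(2, ℤ))
  obtain ⟨A, hAim⟩ := (atImInfty_mem _).mp (hdec.eventually (Iio_mem_nhds hMpos))
  obtain ⟨n, hn⟩ := exists_nat_gt (A / τ₀.im)
  have hnp : (n : ℝ) ≤ (p : ℝ) ^ n := by exact_mod_cast (Nat.lt_pow_self hp.one_lt).le
  have hAn : A ≤ ((fun τ : ℍ ↦ intGL (heckeRep p none) • τ)^[n] τ₀).im := by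
    rw [him n]
    have h0 : 0 < τ₀.im := τ₀.im_pos
    rw [div_lt_iff₀ h0] at hn
    nlinarith [hnp, h0]
  have hcon : P ((fun τ : ℍ ↦ intGL (heckeRep p none) • τ)^[n] τ₀) < M := hAim _ hAn
  rw [hiter n] at hcon
  exact lt_irrefl _ hcon


/-- **Weight two, level `Γ₁(N)`, `p ≡ 1 (mod N)`: `T_p − (1 + p)` is injective on `S₂(Γ₁(N))`** — the Eisenstein
eigenvalue `1 + p` of the cusp `∞` does not occur on weight-`2` cusp forms (weight-`2` companion of
`ker_heckeT_gamma1_sub_eq_bot`). [cite: DiamondShurman2005, Prop. 5.2.1] -/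
theorem ker_heckeT_gamma1_sub_one_add_eq_bot_weight_two (hp : p.Prime) (hp1 : (p : ZMod N) = 1) :
    LinearMap.ker (heckeT (Gamma1 N) 2 p - (1 + (p : ℂ)) • LinearMap.id) = ⊥ := by
  rw [LinearMap.ker_eq_bot']
  intro f hf
  by_contra h0
  have hc : heckeT (Gamma1 N) 2 p f = (1 + (p : ℂ)) • f := by
    have := hf
    rw [LinearMap.sub_apply, LinearMap.smul_apply, LinearMap.id_apply, sub_eq_zero] at this
    exact this
  have h := norm_sq_lt_of_heckeT_gamma1_eq_smul_of_cast_eq_one (k := 2) hp hp1 h0 hc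
  have hnorm : ‖(1 + (p : ℂ))‖ = 1 + (p : ℝ) := by
    rw [show (1 + (p : ℂ)) = ((1 + (p : ℝ) : ℝ) : ℂ) by push_cast; ring, Complex.norm_of_nonneg (by positivity)]
  rw [hnorm] at h
  norm_num at h
  nlinarith [h]

end StrictGamma1


/-! ### Appended (same seat): the strict bound on `S_k(Γ₁(N))` at every prime `p ∤ N` -/

section StrictGamma1General

variable {N : ℕ} [NeZero N] {k : ℤ} {p : ℕ} [NeZero p]

/-- **Strict trivial bound on `S_k(Γ₁(N))`, every prime `p ∤ N`**: `f ≠ 0`, `T_p f = λ f` ⟹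
`‖λ‖² < (p + 1)² p^{k-2}`. The diamond twist `⟨p⟩` of the term `f ∣ diag(p,1)` is handled by running the
propagation of `norm_sq_lt_of_heckeT_eq_smul` through the finite family `gₙ = ⟨pⁿ⟩ f` (all `T_p`-eigenvectors with the
same eigenvalue, `heckeT_diamondOp_comm_holds`; `⟨p⟩ gₙ = g_{n+1}`, `diamondOp_mul_holds`; each `φ_{gₙ} = φ_f ∘ σ` has the
same supremum): a maximum point `τ` of `φ_{gₙ}` gives the maximum point `p τ` of `φ_{g_{n+1}}`; after `n = t·φ(N)` steps
`g_n = f` (`ZMod.pow_totient`) and `φ_f(p^n τ₀) = max φ_f > 0`, contradicting the decay of `φ_f` at `i∞`.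
[cite: DiamondShurman2005, Prop. 5.2.1 and Exercise 5.9.1(a)] -/
theorem norm_sq_lt_of_heckeT_gamma1_eq_smul (hp : p.Prime) (hpN : ¬ p ∣ N)
    {f : CuspForm (Gamma1 N) k} (hf : f ≠ 0) {c : ℂ} (hc : heckeT (Gamma1 N) k p f = c • f) :
    ‖c‖ ^ 2 < ((p : ℝ) + 1) ^ 2 * (p : ℝ) ^ (k - 2) := by
  classical
  -- the family `g n = ⟨p^n⟩ f`
  have hpu : IsUnit (p : ZMod N) := (ZMod.isUnit_prime_iff_not_dvd hp).mpr hpN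
  set g : ℕ → CuspForm (Gamma1 N) k := fun n ↦ diamondOp N k ((p : ZMod N) ^ n) f with hg
  have hg0 : g 0 = f := by
    simp only [hg, pow_zero, diamondOp_one_eq_id, LinearMap.id_apply]
  have hgT : ∀ n, heckeT (Gamma1 N) k p (g n) = c • g n := fun n ↦ by
    simp only [hg]
    rw [← Module.End.mul_apply, heckeT_diamondOp_comm_holds N k p ((p : ZMod N) ^ n), Module.End.mul_apply, hc,
      map_smul]
  have hgsucc : ∀ n, diamondOp N k (p : ZMod N) (g n) = g (n + 1) := fun n ↦ by
    simp only [hg]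
    rw [← Module.End.mul_apply, ← diamondOp_mul_holds N k hpu (hpu.pow n), ← pow_succ']
  have hgper : ∀ t : ℕ, g (t * Nat.totient N) = f := fun t ↦ by
    simp only [hg]
    have h1 : ((p : ZMod N)) ^ (t * Nat.totient N) = 1 := by
      obtain ⟨u, hu⟩ := hpu
      rw [← hu, ← Units.val_pow_eq_pow_val, pow_mul, ZMod.pow_totient, Units.val_one]
    rw [h1, diamondOp_one_eq_id, LinearMap.id_apply]
  -- the invariant function of `f` and its maximum
  obtain ⟨τ₀, hτ₀⟩ := exists_forall_norm_petersson_le f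
  set P : ℍ → ℝ := fun τ ↦ ‖petersson k (⇑f) (⇑f) τ‖ with hP
  set M : ℝ := P τ₀ with hM
  have hPM : ∀ τ, P τ ≤ M := hτ₀
  obtain ⟨τ₁, hτ₁⟩ : ∃ τ₁, f τ₁ ≠ 0 := by
    by_contra h
    push Not at h
    exact hf (CuspForm.ext fun τ ↦ by rw [h τ, CuspForm.zero_apply])
  have hMpos : 0 < M := by
    refine lt_of_lt_of_le ?_ (hPM τ₁)
    simp only [hP, norm_petersson_self]
    exact mul_pos (pow_pos (norm_pos_iff.mpr hτ₁) 2) (zpow_pos τ₁.im_pos k)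
  have hA : (0 : ℝ) < (p : ℝ) ^ (k - 2) := zpow_pos (by exact_mod_cast hp.pos) _
  -- `φ_{g n} ≤ M` everywhere (it is `φ_f ∘ σ` for a lift `σ` of `⟨p^n⟩`)
  have hgle : ∀ n (τ : ℍ), ‖petersson k (⇑(g n)) (⇑(g n)) τ‖ ≤ M := by
    intro n τ
    obtain ⟨σ, hσ⟩ := exists_gamma0Map_eq_holds N (hpu.pow n)
    simp only [hg]
    rw [← hσ, norm_petersson_self_diamondOp]
    exact hPM _
  -- the index set has `p + 1` elements
  set I : ℝ := ((Fintype.card (HeckeIdx N p) : ℕ) : ℝ) with hI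
  have hIeq : I = (p : ℝ) + 1 := by rw [hI, card_heckeIdx_of_not_dvd hpN, Nat.cast_add, Nat.cast_one]
  have hIpos : 0 < I := by rw [hIeq]; positivity
  let iinf : HeckeIdx N p := ⟨none, fun _ ↦ hpN⟩
  -- the key estimate for `g n` at any point
  have hpoint : ∀ (n : ℕ) (τ : ℍ), ‖c‖ ^ 2 * ‖petersson k (⇑(g n)) (⇑(g n)) τ‖ ≤
      I * ((p : ℝ) ^ (k - 2) * ‖petersson k (⇑(g (n + 1))) (⇑(g (n + 1))) (intGL (heckeRep p none) • τ)‖ +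
        (I - 1) * ((p : ℝ) ^ (k - 2) * M)) := by
    intro n τ
    set G := g n with hG
    have hterm_le : ∀ (i : HeckeIdx N p),
        ‖(⇑(diamondOp N k (heckeEps N p i.1) G) ∣[k] intGL (heckeRep p i.1)) τ‖ ^ 2 * τ.im ^ k ≤
          (p : ℝ) ^ (k - 2) * M := by
      intro i
      obtain ⟨_ | j, hi⟩ := i
      · rw [← norm_petersson_self, norm_petersson_self_slash_intGL_heckeRep]
        refine mul_le_mul_of_nonneg_left ?_ hA.le
        change ‖petersson k (⇑(diamondOp N k (p : ZMod N) G)) (⇑(diamondOp N k (p : ZMod N) G)) _‖ ≤ M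
        rw [hG, hgsucc n]
        exact hgle _ _
      · rw [← norm_petersson_self, norm_petersson_self_slash_intGL_heckeRep]
        refine mul_le_mul_of_nonneg_left ?_ hA.le
        change ‖petersson k (⇑(diamondOp N k (1 : ZMod N) G)) (⇑(diamondOp N k (1 : ZMod N) G)) _‖ ≤ M
        rw [diamondOp_one_eq_id, LinearMap.id_apply, hG]
        exact hgle _ _
    have hterm_none :
        ‖(⇑(diamondOp N k (heckeEps N p iinf.1) G) ∣[k] intGL (heckeRep p iinf.1)) τ‖ ^ 2 * τ.im ^ k =
          (p : ℝ) ^ (k - 2) * ‖petersson k (⇑(g (n + 1))) (⇑(g (n + 1))) (intGL (heckeRep p none) • τ)‖ := by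
      rw [← norm_petersson_self, norm_petersson_self_slash_intGL_heckeRep]
      change (p : ℝ) ^ (k - 2) * ‖petersson k (⇑(diamondOp N k (p : ZMod N) G)) (⇑(diamondOp N k (p : ZMod N) G)) _‖ = _
      rw [hG, hgsucc n]
    have hTf : ‖heckeT (Gamma1 N) k p G τ‖ = ‖c‖ * ‖G τ‖ := by
      rw [hG, hgT n, CuspForm.IsGLPos.coe_smul, Pi.smul_apply, smul_eq_mul, norm_mul]
    have hsum : ‖heckeT (Gamma1 N) k p G τ‖ ≤
        ∑ i : HeckeIdx N p, ‖(⇑(diamondOp N k (heckeEps N p i.1) G) ∣[k] intGL (heckeRep p i.1)) τ‖ := by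
      rw [coe_heckeT_gamma1 N k p hp G, Finset.sum_apply]
      exact norm_sum_le _ _
    have hCS := sq_sum_le_card_mul_sum_sq (s := (Finset.univ : Finset (HeckeIdx N p)))
      (f := fun i : HeckeIdx N p ↦
        ‖(⇑(diamondOp N k (heckeEps N p i.1) G) ∣[k] intGL (heckeRep p i.1)) τ‖)
    rw [Finset.card_univ] at hCS
    have hk0 : 0 ≤ τ.im ^ k := zpow_nonneg τ.im_pos.le k
    set s : HeckeIdx N p → ℝ := fun i ↦
      ‖(⇑(diamondOp N k (heckeEps N p i.1) G) ∣[k] intGL (heckeRep p i.1)) τ‖ ^ 2 * τ.im ^ k with hs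
    have hsplit : ∑ i, s i = s iinf + ∑ i ∈ Finset.univ.erase iinf, s i :=
      (Finset.add_sum_erase _ _ (Finset.mem_univ iinf)).symm
    have hrest : ∑ i ∈ Finset.univ.erase iinf, s i ≤ (I - 1) * ((p : ℝ) ^ (k - 2) * M) := by
      have h := Finset.sum_le_card_nsmul (Finset.univ.erase iinf) s ((p : ℝ) ^ (k - 2) * M)
        fun i _ ↦ hterm_le i
      rw [Finset.card_erase_of_mem (Finset.mem_univ _), Finset.card_univ, nsmul_eq_mul] at h
      have hc1 : (((Fintype.card (HeckeIdx N p) - 1 : ℕ)) : ℝ) = I - 1 := by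
        rw [hI, Nat.cast_sub (Fintype.card_pos_iff.mpr ⟨iinf⟩), Nat.cast_one]
      rwa [hc1] at h
    calc ‖c‖ ^ 2 * ‖petersson k (⇑G) (⇑G) τ‖ = ‖heckeT (Gamma1 N) k p G τ‖ ^ 2 * τ.im ^ k := by
          simp only [norm_petersson_self, hTf]; ring
      _ ≤ (∑ i : HeckeIdx N p,
            ‖(⇑(diamondOp N k (heckeEps N p i.1) G) ∣[k] intGL (heckeRep p i.1)) τ‖) ^ 2 * τ.im ^ k :=
          mul_le_mul_of_nonneg_right (pow_le_pow_left₀ (norm_nonneg _) hsum 2) hk0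
      _ ≤ (I * ∑ i : HeckeIdx N p,
            ‖(⇑(diamondOp N k (heckeEps N p i.1) G) ∣[k] intGL (heckeRep p i.1)) τ‖ ^ 2) * τ.im ^ k :=
          mul_le_mul_of_nonneg_right hCS hk0
      _ = I * ∑ i : HeckeIdx N p, s i := by
          rw [mul_assoc, Finset.sum_mul]
      _ = I * (s iinf + ∑ i ∈ Finset.univ.erase iinf, s i) := by rw [hsplit]
      _ ≤ I * ((p : ℝ) ^ (k - 2) * ‖petersson k (⇑(g (n + 1))) (⇑(g (n + 1))) (intGL (heckeRep p none) • τ)‖ +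
            (I - 1) * ((p : ℝ) ^ (k - 2) * M)) := by
          refine mul_le_mul_of_nonneg_left (add_le_add (le_of_eq ?_) hrest) hIpos.le
          exact hterm_none
  -- the non-strict bound is known; suppose equality
  by_contra hlt
  have hge : ((p : ℝ) + 1) ^ 2 * (p : ℝ) ^ (k - 2) ≤ ‖c‖ ^ 2 := not_lt.mp hlt
  -- propagation along the family
  have hstep : ∀ (n : ℕ) (τ : ℍ), ‖petersson k (⇑(g n)) (⇑(g n)) τ‖ = M →
      ‖petersson k (⇑(g (n + 1))) (⇑(g (n + 1))) (intGL (heckeRep p none) • τ)‖ = M := by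
    intro n τ hτ
    refine le_antisymm (hgle _ _) ?_
    have h1 := hpoint n τ
    rw [hτ, hIeq] at h1
    have h2 : ((p : ℝ) + 1) ^ 2 * (p : ℝ) ^ (k - 2) * M ≤ ‖c‖ ^ 2 * M :=
      mul_le_mul_of_nonneg_right hge hMpos.le
    have h3 : ((p : ℝ) + 1) * ((p : ℝ) ^ (k - 2) * M) ≤
        ((p : ℝ) + 1) * ((p : ℝ) ^ (k - 2) *
          ‖petersson k (⇑(g (n + 1))) (⇑(g (n + 1))) (intGL (heckeRep p none) • τ)‖) := by
      nlinarith [h1, h2, hA, hMpos]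
    have h4 := le_of_mul_le_mul_left h3 (by positivity : (0 : ℝ) < (p : ℝ) + 1)
    exact le_of_mul_le_mul_left h4 hA
  have hiter : ∀ n : ℕ,
      ‖petersson k (⇑(g n)) (⇑(g n)) ((fun τ : ℍ ↦ intGL (heckeRep p none) • τ)^[n] τ₀)‖ = M := by
    intro n
    induction n with
    | zero => simp only [Function.iterate_zero, id_eq, hg0]; rfl
    | succ n ih =>
        rw [Function.iterate_succ_apply']
        exact hstep n _ ih
  have him : ∀ n : ℕ, ((fun τ : ℍ ↦ intGL (heckeRep p none) • τ)^[n] τ₀).im = (p : ℝ) ^ n * τ₀.im := by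
    intro n
    induction n with
    | zero => simp
    | succ n ih => rw [Function.iterate_succ_apply', im_intGL_heckeRep_none_smul, ih, pow_succ]; ring
  -- decay of `φ_f` at `i∞`, read at the steps `n = t·φ(N)` where `g n = f`
  have hdec : Tendsto P atImInfty (𝓝 0) := by
    simpa only [hP, one_smul] using tendsto_norm_petersson_smul_atImInfty f (1 : SL(2, ℤ))
  obtain ⟨A, hAim⟩ := (atImInfty_mem _).mp (hdec.eventually (Iio_mem_nhds hMpos))
  obtain ⟨t, ht⟩ := exists_nat_gt (A / τ₀.im)
  have hφ : 0 < Nat.totient N := Nat.totient_pos.mpr (NeZero.pos N)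
  set n : ℕ := t * Nat.totient N with hn
  have htn : (t : ℝ) ≤ n := by
    rw [hn]; exact_mod_cast Nat.le_mul_of_pos_right t hφ
  have hnp : (n : ℝ) ≤ (p : ℝ) ^ n := by exact_mod_cast (Nat.lt_pow_self hp.one_lt).le
  have hAn : A ≤ ((fun τ : ℍ ↦ intGL (heckeRep p none) • τ)^[n] τ₀).im := by
    rw [him n]
    have h0 : 0 < τ₀.im := τ₀.im_pos
    rw [div_lt_iff₀ h0] at ht
    nlinarith [hnp, htn, h0]
  have hcon : P ((fun τ : ℍ ↦ intGL (heckeRep p none) • τ)^[n] τ₀) < M := hAim _ hAn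
  have hgn : g n = f := by rw [hn]; exact hgper t
  have := hiter n
  rw [hgn] at this
  simp only [hP] at hcon
  rw [this] at hcon
  exact lt_irrefl _ hcon

/-- **Every eigenvalue of `T_p` (`p ∤ N` prime) on `S_k(Γ₁(N))` satisfies `‖μ‖ < (p + 1) p^{(k-2)/2}`** (strict Hecke bound,
arbitrary nebentypus). [cite: DiamondShurman2005, Prop. 5.2.1 and Exercise 5.9.1(a)] -/
theorem norm_lt_of_hasEigenvalue_heckeT_gamma1 (hp : p.Prime) (hpN : ¬ p ∣ N) {μ : ℂ}
    (hμ : Module.End.HasEigenvalue (heckeT (Gamma1 N) k p) μ) :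
    ‖μ‖ < ((p : ℝ) + 1) * (p : ℝ) ^ (((k : ℝ) - 2) / 2) := by
  obtain ⟨f, hf⟩ := hμ.exists_hasEigenvector
  have h := norm_sq_lt_of_heckeT_gamma1_eq_smul hp hpN hf.2 hf.apply_eq_smul
  have hp0 : (0 : ℝ) ≤ p := Nat.cast_nonneg p
  refine lt_of_pow_lt_pow_left₀ 2 (by positivity) ?_
  rw [mul_pow, show ((k : ℝ) - 2) = ((k - 2 : ℤ) : ℝ) by push_cast; ring,
    rpow_intCast_div_two_sq hp0 (k - 2)]
  exact h

/-- **Weight two, level `Γ₁(N)`, any prime `p ∤ N`: `‖μ‖ < p + 1`** for every eigenvalue of `T_p` on `S₂(Γ₁(N))`; in particular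
`T_p − (1 + p)` is injective on `S₂(Γ₁(N))` (`ker_heckeT_gamma1_sub_one_add_eq_bot_weight_two'`), the weight-`2` companion of
`ker_heckeT_gamma1_sub_eq_bot`. [cite: DiamondShurman2005, Prop. 5.2.1] -/
theorem norm_lt_of_hasEigenvalue_heckeT_gamma1_weight_two (hp : p.Prime) (hpN : ¬ p ∣ N) {μ : ℂ}
    (hμ : Module.End.HasEigenvalue (heckeT (Gamma1 N) 2 p) μ) :
    ‖μ‖ < (p : ℝ) + 1 := by
  have h := norm_lt_of_hasEigenvalue_heckeT_gamma1 (k := 2) hp hpN hμ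
  norm_num at h
  exact h

/-- `T_p − (1 + p)` is injective on `S₂(Γ₁(N))` for every prime `p ∤ N`. [cite: DiamondShurman2005, Prop. 5.2.1] -/
theorem ker_heckeT_gamma1_sub_one_add_eq_bot_weight_two' (hp : p.Prime) (hpN : ¬ p ∣ N) :
    LinearMap.ker (heckeT (Gamma1 N) 2 p - (1 + (p : ℂ)) • LinearMap.id) = ⊥ := by
  rw [LinearMap.ker_eq_bot']
  intro f hf
  by_contra h0
  have hc : heckeT (Gamma1 N) 2 p f = (1 + (p : ℂ)) • f := by
    have := hf
    rw [LinearMap.sub_apply, LinearMap.smul_apply, LinearMap.id_apply, sub_eq_zero] at this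
    exact this
  have hμ : Module.End.HasEigenvalue (heckeT (Gamma1 N) 2 p) (1 + (p : ℂ)) :=
    Module.End.hasEigenvalue_of_hasEigenvector ⟨Module.End.mem_eigenspace_iff.mpr hc, h0⟩
  have h := norm_lt_of_hasEigenvalue_heckeT_gamma1_weight_two hp hpN hμ
  have hnorm : ‖(1 + (p : ℂ))‖ = 1 + (p : ℝ) := by
    rw [show (1 + (p : ℂ)) = ((1 + (p : ℝ) : ℝ) : ℂ) by push_cast; ring, Complex.norm_of_nonneg (by positivity)]
  rw [hnorm] at h
  linarith

end StrictGamma1General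

end Literature.NumberTheory.EllipticCurves.ModularForms

end
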